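import Literature.AnabelianGeometry.AbsoluteAnabelian.OneParameterSubgroupsPSL2RLie
import Mathlib.Topology.Covering.AddCircle
import Mathlib.Topology.Homotopy.Lifting
import Mathlib.Analysis.Convex.Contractible
import Mathlib.AlgebraicTopology.FundamentalGroupoid.SimplyConnected
import Mathlib.Analysis.LocallyConvex.WithSeminorms
import Mathlib.Topology.Algebra.Module.LocallyConvex
import Mathlib.Topology.Instances.RealVectorSpace

/-!
# One-parameter subgroups of `PSL₂(ℝ)`, IV: lines versus circles
# ([AbsTopIII] Cor. 2.7 (d), PROOF-ONLY infrastructure)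

Towards the discharge of `OneParameterSubgroupsPSL2R` (with parts I–III)
([MochizukiAbsTopIII2015] Corollary 2.7 (d) p.59). Three elementary facts about the LINE `ℝ`
used to separate the hyperbolic/parabolic one-parameter subgroups of `SL₂(ℝ)/{±1}` from the elliptic
ones: (i) there is no continuous injective additive map `ℝ → ℝ/pℤ`
(`not_injective_of_continuous_additive`: lift through the covering `ℝ → ℝ/pℤ` by Mathlib's
`IsCoveringMap.existsUnique_continuousMap_lifts`, the lift is additive and continuous hence linear);
(ii) the line minus a point is disconnected (`not_isPreconnected_compl_one`); (iii) a continuous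
homomorphism into a closed subgroup that is a line `e : ℝ ≅ T` is a rescaling `t ↦ e(at)`
(`exists_eq_line_smul`, continuous additive maps `ℝ → ℝ` are linear).

Everything is a theorem (no definitions, no named facts). No side is taken on anything in
[IUTchIII]; this is classical topology serving a cited reconstruction step of [AbsTopIII] §2.
-/

noncomputable section

open NormedSpace Filter Topology Set

namespace Literature.AnabelianGeometry.AbsoluteAnabelian

namespace OneParameterSubgroupsPSL2R

open Matrix Literature.Analysis.Matrix

open scoped MatrixGroups

/-! ### No continuous injective additive map from the line to a circle -/

/-- **There is no continuous injective additive map `ℝ → ℝ/pℤ`** (`p > 0`): such a map lifts through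
the covering `ℝ → ℝ/pℤ` (the line is simply connected) to a continuous ADDITIVE map `ℝ → ℝ` (the
defect `F(s+t) - F(s) - F(t)` is continuous, `pℤ`-valued and vanishes at `0`), hence `F(t) = at`, and
`t ↦ at mod p` is never injective. Used for Cor. 2.7 (d): an injective one-parameter subgroup of
`SL₂(ℝ)/{±1}` cannot have a circle as closure. [cite: MochizukiAbsTopIII2015, Corollary 2.7 (d) p.59] -/
theorem not_injective_of_continuous_additive {p : ℝ} (hp : 0 < p) (g : ℝ → AddCircle p)
    (hg : Continuous g) (hadd : ∀ s t, g (s + t) = g s + g t) : ¬ Function.Injective g := by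
  intro hinj
  have hg0 : g 0 = 0 := by
    have := hadd 0 0
    rw [add_zero] at this
    exact left_eq_add.mp this
  -- lift through the covering `ℝ → ℝ/pℤ`
  have cov : IsCoveringMap ((↑) : ℝ → AddCircle p) := AddCircle.isCoveringMap_coe p
  obtain ⟨F, ⟨hF0, hFlift⟩, -⟩ :=
    cov.existsUnique_continuousMap_lifts ⟨g, hg⟩ 0 0 (by simpa using hg0.symm)
  have hF : ∀ t, ((F t : ℝ) : AddCircle p) = g t := fun t => congrFun hFlift t
  -- the defect `D (s, t) = F (s + t) - F s - F t` is `pℤ`-valued, continuous, `D (0,0) = 0`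
  let D : ℝ × ℝ → ℝ := fun q => F (q.1 + q.2) - F q.1 - F q.2
  have hDc : Continuous D := by
    have hFc := F.continuous
    exact ((hFc.comp (continuous_fst.add continuous_snd)).sub (hFc.comp continuous_fst)).sub
      (hFc.comp continuous_snd)
  have hDval : ∀ q, ∃ k : ℤ, k • p = D q := by
    intro q
    have h0 : ((D q : ℝ) : AddCircle p) = 0 := by
      simp only [D, QuotientAddGroup.mk_sub, hF, hadd, add_sub_cancel_left, sub_self]
    exact AddSubgroup.mem_zmultiples_iff.mp ((QuotientAddGroup.eq_zero_iff _).mp h0)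
  have hD00 : D (0, 0) = 0 := by simp [D, hF0]
  have hD : ∀ q, D q = 0 := by
    intro q
    obtain ⟨k, hk⟩ := hDval q
    have hR : IsPreconnected (Set.range D) := isPreconnected_range hDc
    -- every value of `D` lies in `pℤ`; `±p/2` do not
    have hhalf : ∀ x ∈ Set.range D, x ≠ p / 2 ∧ x ≠ -(p / 2) := by
      rintro _ ⟨q', rfl⟩
      obtain ⟨k', hk'⟩ := hDval q'
      constructor
      · intro h
        rw [← hk', zsmul_eq_mul] at h
        have h1 : (2 * (k' : ℝ) - 1) * p = 0 := by linarith
        have h2 : (2 * (k' : ℝ) - 1) = 0 := (mul_eq_zero.mp h1).resolve_right hp.ne'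
        have h3 : (2 * k' - 1 : ℤ) = 0 := by exact_mod_cast h2
        omega
      · intro h
        rw [← hk', zsmul_eq_mul] at h
        have h1 : (2 * (k' : ℝ) + 1) * p = 0 := by linarith
        have h2 : (2 * (k' : ℝ) + 1) = 0 := (mul_eq_zero.mp h1).resolve_right hp.ne'
        have h3 : (2 * k' + 1 : ℤ) = 0 := by exact_mod_cast h2
        omega
    rcases lt_trichotomy k 0 with hk0 | hk0 | hk0
    · exfalso
      have hle : D q ≤ -p := by
        rw [← hk, zsmul_eq_mul]
        have : (k : ℝ) ≤ -1 := by exact_mod_cast (show k ≤ -1 by omega)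
        nlinarith
      have hmem : -(p / 2) ∈ Set.range D :=
        hR.Icc_subset ⟨q, rfl⟩ ⟨(0, 0), hD00⟩ ⟨by linarith, by linarith⟩
      exact (hhalf _ hmem).2 rfl
    · rw [← hk, hk0, zero_smul]
    · exfalso
      have hle : p ≤ D q := by
        rw [← hk, zsmul_eq_mul]
        have : (1 : ℝ) ≤ k := by exact_mod_cast (show 1 ≤ k by omega)
        nlinarith
      have hmem : p / 2 ∈ Set.range D :=
        hR.Icc_subset ⟨(0, 0), hD00⟩ ⟨q, rfl⟩ ⟨by linarith, by linarith⟩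
      exact (hhalf _ hmem).1 rfl
  -- so `F` is additive and continuous, hence linear
  let Fₐ : ℝ →+ ℝ :=
    { toFun := F
      map_zero' := hF0
      map_add' := fun s t => by have := hD (s, t); simp only [D] at this; linarith }
  have hlin : ∀ t : ℝ, F t = t * F 1 := by
    intro t
    have := map_real_smul Fₐ F.continuous t 1
    simpa [Fₐ] using this
  set a := F 1 with ha
  by_cases ha0 : a = 0
  · have h1 : g 1 = g 0 := by rw [← hF, ← hF, hlin 1, hlin 0, ha0]; simp
    exact one_ne_zero (hinj h1)
  · have h1 : g (p / a) = g 0 := by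
      rw [← hF, ← hF, hlin (p / a), hlin 0, zero_mul, div_mul_cancel₀ _ ha0]
      rw [QuotientAddGroup.mk_zero]
      exact (QuotientAddGroup.eq_zero_iff _).mpr (AddSubgroup.mem_zmultiples p)
    exact (div_ne_zero hp.ne' ha0) (hinj h1)

/-! ### The real line minus a point is disconnected -/

/-- `ℝ ∖ {0}`, as the subset `{t | t ≠ 1}` of the multiplicative line `Multiplicative ℝ`, is not
preconnected. [cite: MochizukiAbsTopIII2015, Corollary 2.7 (d) p.59] -/
theorem not_isPreconnected_compl_one :
    ¬ IsPreconnected ((Set.univ : Set (Multiplicative ℝ)) \ {1}) := by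
  intro h
  have h' : IsPreconnected ((Set.univ : Set ℝ) \ {0}) := by
    have := h.image Multiplicative.toAdd continuous_toAdd.continuousOn
    have hset : (Multiplicative.toAdd : Multiplicative ℝ → ℝ) ''
        ((Set.univ : Set (Multiplicative ℝ)) \ {1}) = (Set.univ : Set ℝ) \ {0} := by
      ext x
      simp only [Set.mem_image, Set.mem_sdiff, Set.mem_univ, true_and, Set.mem_singleton_iff]
      constructor
      · rintro ⟨y, hy, rfl⟩
        exact fun h0 => hy (toAdd_eq_zero.mp h0)
      · intro hx
        exact ⟨Multiplicative.ofAdd x, fun h1 => hx (by simpa using congrArg Multiplicative.toAdd h1),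
          rfl⟩
    rwa [hset] at this
  have hsub := h'.Icc_subset (a := -1) (b := 1) ⟨Set.mem_univ _, by norm_num⟩
    ⟨Set.mem_univ _, by norm_num⟩
  exact (hsub ⟨by norm_num, by norm_num⟩).2 rfl

/-! ### One-parameter subgroups with a line as closure -/

/-- If the closure `T` of the image of `f : ℝ → SL₂(ℝ)/{±1}` is a LINE (a homeomorphic group
isomorphism `e : ℝ ≅ T`), then `f` is a rescaling of `e`: `f(t) = e(at)` for a real constant `a`
(continuous additive maps `ℝ → ℝ` are linear). [cite: MochizukiAbsTopIII2015, Corollary 2.7 (d) p.59] -/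
theorem exists_eq_line_smul (T : Subgroup (SL(2, ℝ) ⧸ Subgroup.center SL(2, ℝ)))
    (e : Multiplicative ℝ ≃ₜ T) (he : ∀ a b, e (a * b) = e a * e b)
    (f : Multiplicative ℝ →* (SL(2, ℝ) ⧸ Subgroup.center SL(2, ℝ))) (hf : Continuous f)
    (hfT : ∀ t, f t ∈ T) :
    ∃ a : ℝ, ∀ t : ℝ, f (Multiplicative.ofAdd t) =
      ((e (Multiplicative.ofAdd (t * a)) : T) : SL(2, ℝ) ⧸ Subgroup.center SL(2, ℝ)) := by
  have hesymm : ∀ x y : T, e.symm (x * y) = e.symm x * e.symm y := by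
    intro x y
    apply e.injective
    rw [he, e.apply_symm_apply, e.apply_symm_apply, e.apply_symm_apply]
  let g : ℝ → ℝ := fun t => (e.symm ⟨f (Multiplicative.ofAdd t), hfT _⟩).toAdd
  have hgc : Continuous g := by
    have h1 : Continuous fun t : ℝ => (⟨f (Multiplicative.ofAdd t), hfT _⟩ : T) :=
      (hf.comp continuous_ofAdd).subtype_mk _
    exact continuous_toAdd.comp (e.symm.continuous.comp h1)
  have hgadd : ∀ s t, g (s + t) = g s + g t := by
    intro s t
    simp only [g]
    rw [← toAdd_mul, ← hesymm]
    congr 2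
    apply Subtype.ext
    change f (Multiplicative.ofAdd (s + t)) = f (Multiplicative.ofAdd s) * f (Multiplicative.ofAdd t)
    rw [ofAdd_add, map_mul]
  let gₐ : ℝ →+ ℝ :=
    { toFun := g
      map_zero' := by have := hgadd 0 0; rw [add_zero] at this; linarith
      map_add' := hgadd }
  refine ⟨g 1, fun t => ?_⟩
  have hlin : g t = t * g 1 := by
    have := map_real_smul gₐ hgc t 1
    simpa [gₐ] using this
  have : e (Multiplicative.ofAdd (g t)) = ⟨f (Multiplicative.ofAdd t), hfT _⟩ := by
    simp only [g, ofAdd_toAdd, Homeomorph.apply_symm_apply]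
  rw [← hlin, this]

end OneParameterSubgroupsPSL2R

end Literature.AnabelianGeometry.AbsoluteAnabelian

end
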